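import Literature.Analysis.FluidPDE.NewtonLocalPotential
import Literature.Geometry.Lorentzian.Basic
import HarnessLib

/-!
# Far-cone retardation remainder, VII: a decaying `C²` function is the Newtonian potential of its Laplacian

Support file 7 for the brick `SoftEraTubeLift.FarConeRetardationRemainder` of crux
`EIHFluxBalance.ModulatedKerrHandoff` (H′, stmt-FinalStateConjecture-17402; card `soft-era-tube-lift`).
If `W ∈ C²(ℝ³)` tends to `0` at infinity and `ΔW = g` is continuous with compact support, then
`W(x) = ∫ Γ(x − y) g(y) dy`, `Γ(z) = −(4π|z|)⁻¹` (`eq_integral_newtonKernel_of_laplacian`).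
Proof without Liouville or far-field estimates: by the tree's localised Green representation
`W = N₀[ΔW] + Λ[W]` at radii `(R, 2R)` (`Literature.Analysis.FluidPDE.eq_newtonNearPotential_laplacian_add`,
valid for every `C²` function — no support hypothesis), where for `R` large the truncated kernel
`Γ₀ = Γ` on every `z` with `g(x − z) ≠ 0`, so `N₀[ΔW](x)` IS the Newtonian potential, and the
smoothing remainder `Λ[W](x) = ∫ λ(z) W(x − z) dz` only sees `W` on `R ≤ |z| ≤ 2R`, hence is
`≤ sup_{|y| ≥ R − |x|} |W| · ∫|λ^{1,2}|` (`∫|λ^{R,2R}|` is scale invariant) — small. [folklore]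
-/

noncomputable section

open MeasureTheory Set Filter Topology Metric Literature.Geometry.Lorentzian
open Literature.Analysis.FluidPDE
open scoped Laplacian

-- the doubled `FinalStateConjecture` path component is the summit/problem naming scheme
set_option linter.dupNamespace false

namespace Summit.FinalStateConjecture.FinalStateConjecture.Theorems.EIHFluxBalance.ModulatedKerrHandoffBricks.FarCone

variable {W g : E3 → ℝ}

/-- The smoothing remainder `Λ^{R,2R}[W](x)` is small once `W` is small off the ball of radius
`R − ‖x‖`: `|∫ λ(z) W(x − z) dz| ≤ ε ∫|λ^{1,2}|`. [folklore] -/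
theorem abs_newtonFarSmoothing_le {x : E3} {R ε : ℝ} (hR : 0 < R) (hW : Continuous W)
    (hε : ∀ y : E3, R - ‖x‖ ≤ ‖y‖ → |W y| ≤ ε) :
    |newtonFarSmoothing R (2 * R) W x| ≤ ε * ∫ w, |newtonFarLaplacian 1 2 w| := by
  have h12 : (1 : ℝ) < 2 := by norm_num
  have hR2 : R < 2 * R := by linarith
  have hε0 : 0 ≤ ε := (abs_nonneg _).trans (hε (-(R • (EuclideanSpace.single 0 (1 : ℝ) : E3)) + 0)
    (by
      have : ‖R • (EuclideanSpace.single (0 : Fin 3) (1 : ℝ) : E3)‖ = R := by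
        rw [norm_smul, PiLp.norm_single, norm_one, mul_one, Real.norm_eq_abs, abs_of_pos hR]
      rw [add_zero, norm_neg, this]
      linarith [norm_nonneg x]))
  rw [newtonFarSmoothing_apply]
  have hscale : ∫ w, |newtonFarLaplacian R (2 * R) w| = ∫ w, |newtonFarLaplacian 1 2 w| := by
    have := integral_abs_newtonFarLaplacian_scale hR 1 2
    rwa [mul_one, mul_comm] at this
  rw [← hscale, ← integral_const_mul]
  have hint : Integrable (fun z ↦ newtonFarLaplacian R (2 * R) z * W (x - z)) :=
    ((continuous_newtonFarLaplacian hR hR2).mul (hW.comp (continuous_const.sub continuous_id)))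
      |>.integrable_of_hasCompactSupport ((hasCompactSupport_newtonFarLaplacian hR.le hR2).mul_right)
  refine (abs_integral_le_integral_abs).trans (integral_mono hint.abs
    ((integrable_newtonFarLaplacian hR hR2).abs.const_mul ε) fun z ↦ ?_)
  simp only
  rw [abs_mul, mul_comm ε]
  by_cases hz : ‖z‖ < R
  · rw [newtonFarLaplacian_eq_zero_of_lt hR.le hR2 hz, abs_zero, zero_mul, zero_mul]
  · push Not at hz
    refine mul_le_mul_of_nonneg_left (hε _ ?_) (abs_nonneg _)
    have := norm_sub_norm_le z x
    rw [norm_sub_rev] at this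
    linarith

/-- **A decaying `C²` function is the Newtonian potential of its Laplacian**: if `W ∈ C²(ℝ³)`,
`W → 0` at infinity, and `ΔW = g` is continuous with compact support, then
`W(x) = ∫ Γ(x − y) g(y) dy` with `Γ(z) = −(4π|z|)⁻¹`. [folklore] -/
theorem eq_integral_newtonKernel_of_laplacian (hW : ContDiff ℝ 2 W)
    (hW0 : Tendsto W (cocompact E3) (𝓝 0)) (hgc : HasCompactSupport g)
    (hΔ : ∀ y, (Δ W) y = g y) (x : E3) :
    W x = ∫ y, newtonKernel (x - y) * g y := by
  have hWc : Continuous W := hW.continuous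
  -- support radius of `g`
  obtain ⟨ρ, hρ⟩ : ∃ ρ : ℝ, tsupport g ⊆ closedBall (0 : E3) ρ :=
    hgc.isCompact.isBounded.subset_closedBall 0
  -- it suffices to show `|W x - N x| ≤ ε C` for every `ε > 0`
  set C : ℝ := ∫ w, |newtonFarLaplacian 1 2 w| with hC
  have hC0 : 0 ≤ C := integral_nonneg fun _ ↦ abs_nonneg _
  refine eq_of_forall_dist_le fun δ hδ ↦ ?_
  obtain ⟨ε, hε, hεC⟩ : ∃ ε : ℝ, 0 < ε ∧ ε * C ≤ δ :=
    ⟨δ / (C + 1), div_pos hδ (by linarith), by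
      rw [div_mul_eq_mul_div, div_le_iff₀ (by linarith)]; nlinarith⟩
  -- `|W| ≤ ε` off a ball
  have hev : ∀ᶠ y in cocompact E3, |W y| ≤ ε := by
    have := hW0.eventually (Metric.closedBall_mem_nhds (0 : ℝ) hε)
    filter_upwards [this] with y hy
    rwa [Real.dist_eq, sub_zero] at hy
  rw [← Metric.cobounded_eq_cocompact] at hev
  obtain ⟨L, -, hL⟩ := (Metric.hasBasis_cobounded_compl_closedBall (0 : E3)).eventually_iff.1 hev
  -- radii
  set R : ℝ := |L| + |ρ| + ‖x‖ + 1 with hRdef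
  have hR : 0 < R := by positivity
  have hR2 : R < 2 * R := by linarith
  -- localised Green representation at radii `(R, 2R)`
  have hGreen := eq_newtonNearPotential_laplacian_add hR hR2 hW x
  -- the near potential is the full Newtonian potential
  have hnear : newtonNearPotential R (2 * R) (Δ W) x = ∫ y, newtonKernel (x - y) * g y := by
    rw [newtonNearPotential_apply]
    have hpt : ∀ z : E3, newtonNear R (2 * R) z * (Δ W) (x - z) = newtonKernel z * g (x - z) := by
      intro z
      rw [hΔ]
      by_cases hz : x - z ∈ tsupport g
      · have h1 : ‖x - z‖ ≤ ρ := mem_closedBall_zero_iff.1 (hρ hz)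
        have h2 : ‖z‖ ≤ R := by
          have := norm_sub_le x (x - z)
          rw [sub_sub_cancel] at this
          rw [hRdef]
          linarith [le_abs_self ρ, abs_nonneg L]
        rw [newtonNear_eq_newtonKernel hR.le hR2 h2]
      · rw [image_eq_zero_of_notMem_tsupport hz, mul_zero, mul_zero]
    simp_rw [hpt]
    have h := integral_sub_left_eq_self (fun y ↦ newtonKernel (x - y) * g y) volume x
    simp only [sub_sub_cancel] at h
    exact h
  -- the smoothing remainder is small
  have hfar : |newtonFarSmoothing R (2 * R) W x| ≤ ε * C := by
    refine abs_newtonFarSmoothing_le hR hWc fun y hy ↦ hL ?_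
    rw [mem_compl_iff, mem_closedBall, dist_zero_right, not_le]
    rw [hRdef] at hy
    linarith [le_abs_self L, abs_nonneg ρ]
  rw [Real.dist_eq, hGreen, hnear]
  calc |(∫ y, newtonKernel (x - y) * g y) + newtonFarSmoothing R (2 * R) W x -
        ∫ y, newtonKernel (x - y) * g y|
      = |newtonFarSmoothing R (2 * R) W x| := by congr 1; ring
    _ ≤ ε * C := hfar
    _ ≤ δ := hεC

/-! ### Registered form -/

/-- **A decaying `C²` function is the Newtonian potential of its Laplacian** (registered helper of
stmt-FinalStateConjecture-17402, brick `FarConeRetardationRemainder`). [folklore] -/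
theorem farCone_eq_integral_newtonKernel_of_laplacian : ∀ (W g : EuclideanSpace ℝ (Fin 3) → ℝ), ContDiff ℝ 2 W → Filter.Tendsto W (Filter.cocompact (EuclideanSpace ℝ (Fin 3))) (nhds 0) → HasCompactSupport g → (∀ y, (Laplacian.laplacian W : EuclideanSpace ℝ (Fin 3) → ℝ) y = g y) → ∀ x : EuclideanSpace ℝ (Fin 3), W x = MeasureTheory.integral MeasureTheory.volume (fun y : EuclideanSpace ℝ (Fin 3) ↦ Literature.Analysis.FluidPDE.newtonKernel (x - y) * g y) :=
  fun _W _g hW hW0 hgc hΔ x ↦ eq_integral_newtonKernel_of_laplacian hW hW0 hgc hΔ x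

end Summit.FinalStateConjecture.FinalStateConjecture.Theorems.EIHFluxBalance.ModulatedKerrHandoffBricks.FarCone

end
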